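import Mathlib
import HarnessLib
import Summits.Ventures.LatticeQCDFlow.Exactness.InvariantComposition
import Summits.Ventures.LatticeQCDFlow.Exactness.CabibboMarinariKernel

/-!
# The SU(N) heat-bath update of one link — the cycle of Cabibbo–Marinari hits over the subgroup frames — is exact

HONEST FRAMING: exact (Metropolis-corrected) sampling algorithms for lattice gauge theory;
figures of merit are autocorrelation/cost numbers at stated couplings and volumes; no
continuum-physics claim.

Venture `LatticeQCDFlow` (cell pub-lqcd), topic `Exactness`, FANOUT row 9 (eng-latcore; the
engine's `update_link` in `csrc/latcore_template.c`: for `N ≥ 3` one heat-bath hit per SU(2)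
subgroup `(i, j)`, `i < j`, in a fixed (optionally reversed) order).  NEW WORK of the cell: a
one-line assembly of `CabibboMarinariKernel.lean` (`cmHit e c R` is invariant for the one-link
Wilson law) with `InvariantComposition.lean` (`cycle`, `invariant_cycle`); nothing is cited as a fact.

## Content

* `cmLinkUpdate frames c R = cycle (frames.map (cmHit · c R))` — the composite of the subgroup hits
  over any list of frames `frames : List (n ≃ Fin 2 ⊕ m)` (the engine: the `N(N−1)/2` coordinate
  pairs; any order, any repetition, reversed scans included).
* **`cmLinkUpdate_invariant`** — it leaves `e^{c Re tr (g R)} · Haar_SU(n)` invariant;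
  `isMarkovKernel_cmLinkUpdate`.

Not here: ergodicity of the cycle (the subgroups must generate SU(N) — true for the coordinate
pairs, not typed), the over-relaxation hits interleaved by the engine (`WilsonOverrelaxation.lean`
types the `N = 2` reflection; its `N ≥ 3` lift is not filed), the sweep over links
(`FibreLift.lean` / `SchwingerDysonLattice.lean` conditioning + `invariant_cycle` again).
-/

namespace Summit.Ventures.LatticeQCDFlow.Exactness

open MeasureTheory ProbabilityTheory

variable {n m : Type*} [Fintype n] [DecidableEq n] [Fintype m] [DecidableEq m]

/-- **The SU(N) heat-bath update of one link**: the cycle of Cabibbo–Marinari hits over a list of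
subgroup frames (first frame applied last, as in `cycle`). -/
noncomputable def cmLinkUpdate (frames : List (n ≃ Fin 2 ⊕ m)) (c : ℝ) (R : Matrix n n ℂ) :
    Kernel (Matrix.specialUnitaryGroup n ℂ) (Matrix.specialUnitaryGroup n ℂ) :=
  cycle (frames.map fun e => cmHit e c R)

/-- The composite update is a Markov kernel. -/
instance isMarkovKernel_cmLinkUpdate (frames : List (n ≃ Fin 2 ⊕ m)) (c : ℝ) (R : Matrix n n ℂ) :
    IsMarkovKernel (cmLinkUpdate frames c R) := by
  unfold cmLinkUpdate
  induction frames with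
  | nil => rw [List.map_nil, cycle_nil]; infer_instance
  | cons e es ih => rw [List.map_cons, cycle_cons]; infer_instance

/-- **The SU(N) heat-bath update of one link is exact**: for every list of subgroup frames, every
real `c` and every staple sum `R`, the cycle of Cabibbo–Marinari hits leaves the one-link Wilson law
`e^{c Re tr (g R)} · Haar_SU(n)` invariant. -/
theorem cmLinkUpdate_invariant (frames : List (n ≃ Fin 2 ⊕ m)) (c : ℝ) (R : Matrix n n ℂ) :
    Kernel.Invariant (cmLinkUpdate frames c R)
      ((Literature.MathematicalPhysics.QuantumFieldTheory.haarProbability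
        (Matrix.specialUnitaryGroup n ℂ)).withDensity (linkWeight c R)) := by
  unfold cmLinkUpdate
  refine invariant_cycle fun κ hκ => ?_
  obtain ⟨e, -, rfl⟩ := List.mem_map.mp hκ
  exact cmHit_invariant e c R

end Summit.Ventures.LatticeQCDFlow.Exactness
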